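import Literature.Combinatorics.Designs.TSequences

/-!
# Base sequences, Turyn-type sequences, and the passage to T-sequences

[Best–Đoković–Kharaghani–Ramp, J. Combin. Des. 21 (2013) 24–35 = arXiv:1206.4107] (`BestDjokovicKharaghaniRamp2013`),
§1 and §5 (recalling Turyn, JCT-A 16 (1974), `Turyn1974`), and [Seberry–Yamada, *Hadamard Matrices*, Wiley 2020]
(`SeberryYamada2020`) Definitions 5.3 (6-Turyn-type sequences), 5.4 (base sequences), Theorem 5.2, Lemma 1.22:
* *base sequences* `BS(m, m, n, n)`: four `±1` sequences `A, B` (length `m`) and `C, D` (length `n`) with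
  `N(A) + N(B) + N(C) + N(D) = 2(m + n)`, i.e. the aperiodic autocorrelations sum to `0` at every shift `s ≥ 1`;
* *Turyn-type sequences* `TT(n)`: four `±1` sequences `X, Y, Z` (length `n`) and `W` (length `n - 1`) with
  `N(X) + N(Y) + 2N(Z) + 2N(W) = 6n - 2`, i.e. `N_X(s) + N_Y(s) + 2N_Z(s) + 2N_W(s) = 0` for `s ≥ 1`;
* §5: if `(X; Y; Z; W)` are `TT(n)` then `(Z,W; Z,-W; X; Y)` are base sequences of lengths `2n-1, 2n-1, n, n`
  (`turynType_baseSeq`), and if `(A; B; C; D)` are `BS(m, m, n, n)` then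
  `((A+B)/2, 0_n; (A-B)/2, 0_n; 0_m, (C+D)/2; 0_m, (C-D)/2)` are T-sequences of length `m + n` (`baseSeq_tseq`).
Composed with the Cooper–Wallis step of `TSequences.lean`: **`TT(n)` gives a Hadamard matrix of order `4(3n - 1)`**
(`turynType_isHadamard`; `n = 36 ↦ 428`, Kharaghani–Tayfeh-Rezaie 2005; `n = 56 ↦ 668`, open — BDKR 2013 §1) and
**`BS(m, m, n, n)` gives a Hadamard matrix of order `4(m + n)`** (`baseSeq_isHadamard`; BDKR 2013 §1).

Formalisation choices (as in `TSequences.lean`): sequences are `ℕ → ℤ` with explicit lengths; concatenation is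
`cat m x y i = if i < m then x i else y (i - m)`; the half-sum `(a+b)/2` and half-difference `(a-b)/2` of `±1`
sequences are written division-free (`hsum a b i = if a i = b i then a i else 0`, `hdiff a b i = if a i = b i then 0
else a i`).  The one computation is `npaf_cat`: `N_{(x;y)}(s) = N_x(s) + N_y(s) + (cross term)`, the cross term changing
sign with `y` — whence `N_{(z;w)} + N_{(z;-w)} = 2N_z + 2N_w`.  Cell pub-namedobj (venture DiscreteObjects), target H:
typed skeleton of the Turyn-type / base-sequence family (`TT(56)`, `BS(84, 84, 83, 83)` ⇒ `H(668)`).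
No `sorry`, no new axioms.
-/

open Finset BigOperators Matrix

namespace Literature.Combinatorics.Designs.BaseSequences

open Literature.Combinatorics.Designs.LegendrePairs (PAF IsPM)
open Literature.Combinatorics.Designs.GoethalsSeidel (gsMatrix IsHadamardMatrix)
open Literature.Combinatorics.Designs.TSequences

/-! ## §1 Definitions -/

/-- **base sequences** `BS(m, m, n, n)`: `a, b` of length `m` and `c, d` of length `n`, all `±1`, with
`N_a(s) + N_b(s) + N_c(s) + N_d(s) = 0` for every shift `s ≥ 1` (stated for `s < m + n`; automatic beyond);
BDKR 2013 §5 (`N(A)+N(B)+N(C)+N(D) = 2(m+n)`). [cite: SeberryYamada2020, Definition 5.4] -/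
def IsBaseSeq (m n : ℕ) (a b c d : ℕ → ℤ) : Prop :=
  PMOn m a ∧ PMOn m b ∧ PMOn n c ∧ PMOn n d ∧
    ∀ s < m + n, s ≠ 0 → NPAF m a s + NPAF m b s + NPAF n c s + NPAF n d s = 0

/-- **Turyn-type sequences** `TT(n)`: `x, y, z` of length `n` and `w` of length `n - 1`, all `±1`, with
`N_x(s) + N_y(s) + 2N_z(s) + 2N_w(s) = 0` for every shift `1 ≤ s < n` (equivalently
`N(X) + N(Y) + 2N(Z) + 2N(W) = 6n - 2`); the same objects as the "6-Turyn-type sequences `X, Y, Z, Z, W, W` of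
lengths `n, n, n, n, n-1, n-1`" of SY 2020 Definition 5.3. [cite: BestDjokovicKharaghaniRamp2013, §1] -/
def IsTurynType (n : ℕ) (x y z w : ℕ → ℤ) : Prop :=
  PMOn n x ∧ PMOn n y ∧ PMOn n z ∧ PMOn (n - 1) w ∧
    ∀ s < n, s ≠ 0 → NPAF n x s + NPAF n y s + 2 * NPAF n z s + 2 * NPAF (n - 1) w s = 0

/-- concatenation ("adjoining") `{x, y}` of a sequence `x` of length `m` with a sequence `y` (the "comma" of
BDKR 2013 §5). [cite: SeberryYamada2020, Notation 1.44] -/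
def cat (m : ℕ) (x y : ℕ → ℤ) : ℕ → ℤ := fun i => if i < m then x i else y (i - m)

/-- the cross-correlation term of a concatenation `(x ; y)` (`x` of length `m`, `y` of length `k`) at shift `s`:
the products `x_i · y_{i+s-m}` over the positions `i < m ≤ i + s < m + k`. [folklore] -/
def catCross (m k : ℕ) (x y : ℕ → ℤ) (s : ℕ) : ℤ :=
  ∑ i ∈ ((range (m + k - s)).filter (fun i => ¬ (i + s < m))).filter (fun i => ¬ (m ≤ i)), x i * y (i + s - m)

/-! ## §2 Aperiodic autocorrelation of a concatenation -/

/-- `N_{(x;y)}(s) = N_x(s) + N_y(s) + (cross term)` — the computation behind "adjoining `{A₁, A₂}, {A₁, -A₂}`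
preserves complementarity". [cite: SeberryYamada2020, Lemma 1.22 (iii) (proof)] -/
theorem npaf_cat (m k : ℕ) (x y : ℕ → ℤ) (s : ℕ) :
    NPAF (m + k) (cat m x y) s = NPAF m x s + NPAF k y s + catCross m k x y s := by
  unfold NPAF catCross
  rw [← Finset.sum_filter_add_sum_filter_not (range (m + k - s)) (fun i => i + s < m),
    ← Finset.sum_filter_add_sum_filter_not ((range (m + k - s)).filter (fun i => ¬ (i + s < m)))
      (fun i => m ≤ i), add_assoc]
  congr 1
  · have hset : (range (m + k - s)).filter (fun i => i + s < m) = range (m - s) := by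
      ext i
      simp only [mem_filter, mem_range]
      omega
    rw [hset]
    refine sum_congr rfl fun i hi => ?_
    rw [mem_range] at hi
    have e1 : cat m x y i = x i := if_pos (by omega)
    have e2 : cat m x y (i + s) = x (i + s) := if_pos (by omega)
    rw [e1, e2]
  · congr 1
    · have hset : ((range (m + k - s)).filter (fun i => ¬ (i + s < m))).filter (fun i => m ≤ i)
          = Ico m (m + k - s) := by
        ext i
        simp only [mem_filter, mem_range, mem_Ico]
        omega
      rw [hset, Finset.sum_Ico_eq_sum_range, show m + k - s - m = k - s by omega]
      refine sum_congr rfl fun j hj => ?_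
      rw [mem_range] at hj
      have e1 : cat m x y (m + j) = y j := by
        rw [show cat m x y (m + j) = y (m + j - m) from if_neg (by omega), Nat.add_sub_cancel_left]
      have e2 : cat m x y (m + j + s) = y (j + s) := by
        rw [show cat m x y (m + j + s) = y (m + j + s - m) from if_neg (by omega),
          show m + j + s - m = j + s by omega]
      rw [e1, e2]
    · refine sum_congr rfl fun i hi => ?_
      simp only [mem_filter, mem_range] at hi
      have e1 : cat m x y i = x i := if_pos (by omega)
      have e2 : cat m x y (i + s) = y (i + s - m) := if_neg (by omega)
      rw [e1, e2]

/-- negating a sequence does not change its aperiodic autocorrelation. [cite: SeberryYamada2020, Lemma 1.22 (ii)] -/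
lemma npaf_neg (k : ℕ) (y : ℕ → ℤ) (s : ℕ) : NPAF k (fun i => -y i) s = NPAF k y s := by
  simp [NPAF]

/-- the zero sequence has zero autocorrelation. [folklore] -/
private lemma npaf_zero (k s : ℕ) : NPAF k (fun _ => (0 : ℤ)) s = 0 := by
  simp [NPAF]

/-- the cross term changes sign with the second sequence. [folklore] -/
private lemma catCross_neg (m k : ℕ) (x y : ℕ → ℤ) (s : ℕ) :
    catCross m k x (fun i => -y i) s = -catCross m k x y s := by
  simp [catCross, Finset.sum_neg_distrib]

/-- `N_{(z;w)}(s) + N_{(z;-w)}(s) = 2N_z(s) + 2N_w(s)`: the cross terms cancel ("`{A₁, A₂}, {A₁, -A₂}` are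
complementary sequences of length `2n`"; used in BDKR 2013 §5 for TT(n) ⇒ base sequences).
[cite: SeberryYamada2020, Lemma 1.22 (iii)] -/
theorem npaf_cat_pair (m k : ℕ) (z w : ℕ → ℤ) (s : ℕ) :
    NPAF (m + k) (cat m z w) s + NPAF (m + k) (cat m z (fun i => -w i)) s = 2 * NPAF m z s + 2 * NPAF k w s := by
  rw [npaf_cat, npaf_cat, npaf_neg, catCross_neg]
  ring

/-- right zero-padding `{x, 0_k}` does not change the autocorrelation ("sequences are first padded with sufficient
zeros added to the end", SY 2020 §1.10 before Definition 1.41). [cite: SeberryYamada2020, §1.10 (padding remark after (1.15))] -/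
theorem npaf_padRight (m k : ℕ) (x : ℕ → ℤ) (s : ℕ) : NPAF (m + k) (cat m x fun _ => 0) s = NPAF m x s := by
  rw [npaf_cat, npaf_zero]
  simp [catCross]

/-- left zero-padding `{0_m, y}` does not change the autocorrelation (as used for the T-sequences `{0_m, (C+D)/2}`
of BDKR 2013 §5 / SY 2020 Theorem 5.2). [cite: SeberryYamada2020, Theorem 5.2 (proof)] -/
theorem npaf_padLeft (m k : ℕ) (y : ℕ → ℤ) (s : ℕ) : NPAF (m + k) (cat m (fun _ => 0) y) s = NPAF k y s := by
  rw [npaf_cat, npaf_zero]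
  simp [catCross]

/-! ## §3 Turyn-type sequences give base sequences -/

/-- **TT(n) ⇒ BS(2n-1, 2n-1, n, n)**: `(z, w ; z, -w ; x ; y)`. [cite: BestDjokovicKharaghaniRamp2013, §5] -/
theorem turynType_baseSeq {n : ℕ} {x y z w : ℕ → ℤ} (h : IsTurynType n x y z w) :
    IsBaseSeq (n + (n - 1)) n (cat n z w) (cat n z fun i => -w i) x y := by
  obtain ⟨hx, hy, hz, hw, hN⟩ := h
  refine ⟨?_, ?_, hx, hy, ?_⟩
  · intro i hi
    unfold cat
    split_ifs with h
    · exact hz i h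
    · exact hw (i - n) (by omega)
  · intro i hi
    unfold cat
    split_ifs with h
    · exact hz i h
    · rcases hw (i - n) (by omega) with e | e <;> simp [e]
  · intro s _ hs0
    have key := npaf_cat_pair n (n - 1) z w s
    by_cases hsn : s < n
    · have := hN s hsn hs0
      linarith
    · rw [not_lt] at hsn
      have h1 := npaf_of_le x hsn
      have h2 := npaf_of_le y hsn
      have h3 := npaf_of_le z hsn
      have h4 : NPAF (n - 1) w s = 0 := npaf_of_le w (by omega)
      linarith

/-! ## §4 Base sequences give T-sequences -/

/-- `(a + b)/2` for `±1` sequences, division-free (SY 2020 §1.10, "disjointable" sequences).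
[cite: BestDjokovicKharaghaniRamp2013, §5] -/
def hsum (a b : ℕ → ℤ) : ℕ → ℤ := fun i => if a i = b i then a i else 0

/-- `(a - b)/2` for `±1` sequences, division-free (SY 2020 §1.10, "disjointable" sequences).
[cite: BestDjokovicKharaghaniRamp2013, §5] -/
def hdiff (a b : ℕ → ℤ) : ℕ → ℤ := fun i => if a i = b i then 0 else a i

/-- the pointwise identity `2(u₊u'₊ + u₋u'₋) = uu' + vv'` behind `N_{(a+b)/2} + N_{(a-b)/2} = (N_a + N_b)/2`,
where `u₊ = (u+v)/2`, `u₋ = (u-v)/2`. [folklore] -/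
private lemma two_mul_hsum_hdiff {u v u' v' : ℤ} (hu : u = 1 ∨ u = -1) (hv : v = 1 ∨ v = -1)
    (hu' : u' = 1 ∨ u' = -1) (hv' : v' = 1 ∨ v' = -1) :
    2 * ((if u = v then u else 0) * (if u' = v' then u' else 0) +
        (if u = v then 0 else u) * (if u' = v' then 0 else u')) = u * u' + v * v' := by
  rcases hu with rfl | rfl <;> rcases hv with rfl | rfl <;> rcases hu' with rfl | rfl <;>
    rcases hv' with rfl | rfl <;> norm_num

/-- `2 (N_{(a+b)/2}(s) + N_{(a-b)/2}(s)) = N_a(s) + N_b(s)` for `±1` sequences of length `m` (the half-sum and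
half-difference of two complementary `±1` sequences are complementary of half the weight: SY 2020 §1.10,
"m-complementary disjointable sequences"). [cite: BestDjokovicKharaghaniRamp2013, §5] -/
theorem two_mul_npaf_half {m : ℕ} {a b : ℕ → ℤ} (ha : PMOn m a) (hb : PMOn m b) (s : ℕ) :
    2 * (NPAF m (hsum a b) s + NPAF m (hdiff a b) s) = NPAF m a s + NPAF m b s := by
  unfold NPAF hsum hdiff
  rw [← Finset.sum_add_distrib, ← Finset.sum_add_distrib, Finset.mul_sum]
  refine sum_congr rfl fun i hi => ?_
  rw [mem_range] at hi
  exact two_mul_hsum_hdiff (ha i (by omega)) (hb i (by omega)) (ha (i + s) (by omega)) (hb (i + s) (by omega))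

/-- the T-sequences of base sequences `(a; b; c; d)` with `a, b` of length `m`:
`((a+b)/2, 0 ; (a-b)/2, 0 ; 0_m, (c+d)/2 ; 0_m, (c-d)/2)`. [cite: BestDjokovicKharaghaniRamp2013, §5] -/
def bsT (m : ℕ) (a b c d : ℕ → ℤ) : Fin 4 → ℕ → ℤ :=
  ![cat m (hsum a b) fun _ => 0, cat m (hdiff a b) fun _ => 0, cat m (fun _ => 0) (hsum c d),
    cat m (fun _ => 0) (hdiff c d)]

/-- component `0` of `bsT`. [cite: BestDjokovicKharaghaniRamp2013, §5] -/
@[simp] lemma bsT_zero (m : ℕ) (a b c d : ℕ → ℤ) : bsT m a b c d 0 = cat m (hsum a b) fun _ => 0 := rfl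
/-- component `1` of `bsT`. [cite: BestDjokovicKharaghaniRamp2013, §5] -/
@[simp] lemma bsT_one (m : ℕ) (a b c d : ℕ → ℤ) : bsT m a b c d 1 = cat m (hdiff a b) fun _ => 0 := rfl
/-- component `2` of `bsT`. [cite: BestDjokovicKharaghaniRamp2013, §5] -/
@[simp] lemma bsT_two (m : ℕ) (a b c d : ℕ → ℤ) : bsT m a b c d 2 = cat m (fun _ => 0) (hsum c d) := rfl
/-- component `3` of `bsT`. [cite: BestDjokovicKharaghaniRamp2013, §5] -/
@[simp] lemma bsT_three (m : ℕ) (a b c d : ℕ → ℤ) : bsT m a b c d 3 = cat m (fun _ => 0) (hdiff c d) := rfl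

/-- the support pattern: if two of four values are `(u+v)/2` and `(u-v)/2` (division-free forms) for `u = ±1` and
the other two are `0`, then exactly one of the four is non-zero and it is `±1`. [folklore] -/
private lemma support_of_pair {u : ℤ} (v : ℤ) (hu : u = 1 ∨ u = -1) (f : Fin 4 → ℤ) (k₁ k₂ : Fin 4)
    (h1 : f k₁ = if u = v then u else 0) (h2 : f k₂ = if u = v then 0 else u)
    (h0 : ∀ k, k ≠ k₁ → k ≠ k₂ → f k = 0) :
    ∃ k, (f k = 1 ∨ f k = -1) ∧ ∀ k', k' ≠ k → f k' = 0 := by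
  by_cases huv : u = v
  · refine ⟨k₁, ?_, fun k' hk' => ?_⟩
    · rw [h1, if_pos huv]; exact hu
    · by_cases hk2 : k' = k₂
      · rw [hk2, h2, if_pos huv]
      · exact h0 k' hk' hk2
  · refine ⟨k₂, ?_, fun k' hk' => ?_⟩
    · rw [h2, if_neg huv]; exact hu
    · by_cases hk1 : k' = k₁
      · rw [hk1, h1, if_neg huv]
      · exact h0 k' hk1 hk'

/-- **BS(m, m, n, n) ⇒ T-sequences of length m + n** (SY 2020 Theorem 5.2 proof / Corollary 5.3 for the same step).
[cite: BestDjokovicKharaghaniRamp2013, §5] -/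
theorem baseSeq_tseq {m n : ℕ} {a b c d : ℕ → ℤ} (h : IsBaseSeq m n a b c d) :
    IsTSeq (m + n) (bsT m a b c d) := by
  obtain ⟨ha, hb, hc, hd, hN⟩ := h
  refine ⟨fun i hi => ?_, fun s hs hs0 => ?_⟩
  · by_cases him : i < m
    · refine support_of_pair (b i) (ha i him) (fun k => bsT m a b c d k i) 0 1 ?_ ?_ ?_
      · simp [cat, hsum, him]
      · simp [cat, hdiff, him]
      · intro k hk0 hk1
        fin_cases k <;> simp_all [cat]
    · have hin : i - m < n := by omega
      refine support_of_pair (d (i - m)) (hc _ hin) (fun k => bsT m a b c d k i) 2 3 ?_ ?_ ?_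
      · simp [cat, hsum, him]
      · simp [cat, hdiff, him]
      · intro k hk2 hk3
        fin_cases k <;> simp_all [cat]
  · have e : ∑ k, NPAF (m + n) (bsT m a b c d k) s
        = NPAF m (hsum a b) s + NPAF m (hdiff a b) s + (NPAF n (hsum c d) s + NPAF n (hdiff c d) s) := by
      rw [Fin.sum_univ_four, bsT_zero, bsT_one, bsT_two, bsT_three, npaf_padRight, npaf_padRight, npaf_padLeft,
        npaf_padLeft, add_assoc]
    have h2 := two_mul_npaf_half ha hb s
    have h3 := two_mul_npaf_half hc hd s
    have h4 := hN s hs hs0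
    rw [e]
    linarith

/-! ## §5 Compositions: Hadamard matrices from base sequences and from Turyn-type sequences -/

/-- the T-sequences of Turyn-type sequences `(x; y; z; w)`: those of the base sequences `(z,w ; z,-w ; x ; y)`.
[cite: BestDjokovicKharaghaniRamp2013, §5] -/
def ttT (n : ℕ) (x y z w : ℕ → ℤ) : Fin 4 → ℕ → ℤ :=
  bsT (n + (n - 1)) (cat n z w) (cat n z fun i => -w i) x y

/-- **TT(n) ⇒ T-sequences of length (2n - 1) + n = 3n - 1.** [cite: BestDjokovicKharaghaniRamp2013, §5] -/
theorem turynType_tseq {n : ℕ} {x y z w : ℕ → ℤ} (h : IsTurynType n x y z w) :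
    IsTSeq (n + (n - 1) + n) (ttT n x y z w) :=
  baseSeq_tseq (turynType_baseSeq h)

/-- the same with the length as a parameter (`L = 3n - 1`), convenient for numerals.
[cite: BestDjokovicKharaghaniRamp2013, §5] -/
theorem turynType_tseq' {n : ℕ} {x y z w : ℕ → ℤ} (h : IsTurynType n x y z w) (L : ℕ) (hL : L = n + (n - 1) + n) :
    IsTSeq L (ttT n x y z w) := by
  subst hL
  exact turynType_tseq h

/-- **Base sequences give Hadamard matrices**: `BS(m, m, n, n)` ⇒ a Hadamard matrix of order `4(m + n)` through
T-sequences, the Cooper–Wallis combinations and the Goethals–Seidel array (length `L = m + n` as a parameter);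
BDKR 2013 §1 ("base sequences of lengths m, m, n, n … a Hadamard matrix of order 4(m+n)").
[cite: SeberryYamada2020, Corollary 5.3–5.4 (the case 71, 71, 36, 36 ↦ 428) and Theorem 3.11] -/
theorem baseSeq_isHadamard {m n : ℕ} {a b c d : ℕ → ℤ} (h : IsBaseSeq m n a b c d) (L : ℕ) [NeZero L]
    (hL : L = m + n) :
    IsHadamardMatrix (gsMatrix (cwSeq L (bsT m a b c d) 0) (cwSeq L (bsT m a b c d) 1)
      (cwSeq L (bsT m a b c d) 2) (cwSeq L (bsT m a b c d) 3)) := by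
  subst hL
  exact tseq_isHadamard (baseSeq_tseq h)

/-- **Turyn-type sequences give Hadamard matrices**: `TT(n)` ⇒ a Hadamard matrix of order `4(3n - 1)`
(`n = 36 ↦ 428`; `n = 56 ↦ 668`), length `L = 3n - 1` as a parameter; BDKR 2013 §1 ("TT(56) and TT(60) may be used
to construct Hadamard matrices of orders 668 and 716"). [cite: SeberryYamada2020, Theorem 5.2 (order 4(2m+n), m = n)] -/
theorem turynType_isHadamard {n : ℕ} {x y z w : ℕ → ℤ} (h : IsTurynType n x y z w) (L : ℕ) [NeZero L]
    (hL : L = n + (n - 1) + n) :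
    IsHadamardMatrix (gsMatrix (cwSeq L (ttT n x y z w) 0) (cwSeq L (ttT n x y z w) 1)
      (cwSeq L (ttT n x y z w) 2) (cwSeq L (ttT n x y z w) 3)) :=
  tseq_isHadamard (turynType_tseq' h L hL)

/-- existence form: `TT(n)` ⇒ a Hadamard matrix of order `4L`, `L = 3n - 1`; BDKR 2013 §1.
[cite: SeberryYamada2020, Theorem 5.2] -/
theorem exists_hadamard_of_turynType {n : ℕ} {x y z w : ℕ → ℤ} (h : IsTurynType n x y z w) (L : ℕ) [NeZero L]
    (hL : L = n + (n - 1) + n) :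
    ∃ H : Matrix (Fin 4 × ZMod L) (Fin 4 × ZMod L) ℤ, IsHadamardMatrix H :=
  ⟨_, turynType_isHadamard h L hL⟩

/-- existence form: `BS(m, m, n, n)` ⇒ a Hadamard matrix of order `4L`, `L = m + n`; BDKR 2013 §1.
[cite: SeberryYamada2020, Corollary 5.3–5.4 and Theorem 3.11] -/
theorem exists_hadamard_of_baseSeq {m n : ℕ} {a b c d : ℕ → ℤ} (h : IsBaseSeq m n a b c d) (L : ℕ) [NeZero L]
    (hL : L = m + n) :
    ∃ H : Matrix (Fin 4 × ZMod L) (Fin 4 × ZMod L) ℤ, IsHadamardMatrix H :=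
  ⟨_, baseSeq_isHadamard h L hL⟩

end Literature.Combinatorics.Designs.BaseSequences
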